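import Summits.ResolutionOfSingularities.ResolutionOfSingularities.Theorems.WeightedInvariantHypersurfaceCentreChoiceToDatum
import HarnessLib

/-!
# Door assembly H2c″ — the OBJECTS: `ι` at a point, its maximum locus, and the canonical centre of a hypersurface pair

Route `ResolutionOfSingularities/WeightedInvariant`, crux `Theses.WeightedInvariant.HypersurfaceCentreConstruction`
(stmt-ResolutionOfSingularities-19897), door line `local-engine`; res-L1-w43-plan-1 ORDER (o17)(b) to res-L1-w43-stub-9
(= res-D-brk-1): the sorry-free DEFINITIONS of the assembly decomposition of record `door_assembly_eft3_v1.lean`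
(sha16 c97a3399deb30939, evidence on 19897), so that the six assembly stubs [S1]–[S6] are statements over TREE constants.

Given a class function `ι : (R, g) ↦ Ordinal` (the local game's rank; H2a‴ `LocalWeightedDropEFT3`) and a class function
`J : (R, g) ↦ (ℕ → Ideal R)` (the canonical centre filtration):
* `localGenerator X y` — a generator of the stalk `X_y` of an ideal sheaf when it is principal (junk `0` otherwise);
* `iotaAt ι X y := ι(𝒪_{Y,y}, f_y)` — the rank of the pair `(Y, X)` at `y` (well defined up to the unit ambiguity of `f_y`,
  which H2a‴'s unit clauses (c12a) absorb);
* `iotaMax ι X` — its supremum over the non-regular locus `singImage X` of `V(X)`; `maxLocus ι X` — the maximum locus;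
* `IsCanonicalCentre ι J X R` — `R : ReesAlgebraData Y` is THE canonical centre: support `= maxLocus`, stalk filtration
  `J(𝒪_{Y,y}, f_y)` on it, trivial off it;
* `centreRule ι J f X` — the TOTAL centre rule (the canonical centre when one exists, the unit Rees algebra otherwise),
  with `centreRule_spec`, `centreRule_of_not_exists`, `support_centreRule_subset_singImage`.
Definitions and bookkeeping only; no stub is consumed and nothing about Hironaka's problem is claimed. AI-written,
weaker than expert review.
-/

noncomputable section

set_option linter.dupNamespace false -- mandated namespace of this single-conjunct summit

open CategoryTheory AlgebraicGeometry TopologicalSpace IsLocalRing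
open Literature.AlgebraicGeometry.Resolution
open Summit.ResolutionOfSingularities.ResolutionOfSingularities.Theorems

namespace Summit.ResolutionOfSingularities.ResolutionOfSingularities.Cruxes.HypersurfaceCentreConstruction.LocalEngine

section Pointwise

variable (ι : (R : Type) → [CommRing R] → R → Ordinal.{0}) (J : (R : Type) → [CommRing R] → R → ℕ → Ideal R)

open scoped Classical in
/-- A generator of the stalk `X_y ⊆ 𝒪_{Y,y}` of an ideal sheaf, if that stalk is principal (junk `0` otherwise): a LOCAL
EQUATION of the locally principal hypersurface `V(X)` at `y`, defined up to a unit. [folklore] -/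
def localGenerator {Y : Scheme.{0}} (X : Y.IdealSheafData) (y : Y) : Y.presheaf.stalk y :=
  if h : ∃ g : Y.presheaf.stalk y, stalkIdeal X y = Ideal.span {g} then Classical.choose h else 0

/-- When the stalk is principal, `localGenerator` generates it. [folklore] -/
theorem stalkIdeal_eq_span_localGenerator {Y : Scheme.{0}} (X : Y.IdealSheafData) (y : Y)
    (h : ∃ g : Y.presheaf.stalk y, stalkIdeal X y = Ideal.span {g}) :
    stalkIdeal X y = Ideal.span {localGenerator X y} := by
  classical
  unfold localGenerator
  rw [dif_pos h]
  exact Classical.choose_spec h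

/-- **`ι` of the pair at the point `y`**: `ι(𝒪_{Y,y}, f_y)` for the local equation `f_y = localGenerator X y`.
[folklore] -/
def iotaAt {Y : Scheme.{0}} (X : Y.IdealSheafData) (y : Y) : Ordinal.{0} :=
  ι (Y.presheaf.stalk y) (localGenerator X y)

/-- **The maximum of `ι` over the non-regular locus of `V(X)`** (an ordinal supremum; `0` if that locus is empty).
[folklore] -/
def iotaMax {Y : Scheme.{0}} (X : Y.IdealSheafData) : Ordinal.{0} :=
  ⨆ y : {y : Y // y ∈ singImage X}, iotaAt ι X y

/-- **The maximum locus** `M = {y ∈ Sing V(X) | ι_y = ι_max}` — the support of the canonical centre. [folklore] -/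
def maxLocus {Y : Scheme.{0}} (X : Y.IdealSheafData) : Set Y :=
  {y | y ∈ singImage X ∧ iotaAt ι X y = iotaMax ι X}

/-- The maximum locus lies in the non-regular locus of `V(X)`. [folklore] -/
theorem maxLocus_subset_singImage {Y : Scheme.{0}} (X : Y.IdealSheafData) : maxLocus ι X ⊆ singImage X :=
  fun _ hy => hy.1

/-- `ι_y ≤ ι_max` on the non-regular locus. [folklore] -/
theorem iotaAt_le_iotaMax {Y : Scheme.{0}} (X : Y.IdealSheafData) {y : Y} (hy : y ∈ singImage X) :
    iotaAt ι X y ≤ iotaMax ι X :=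
  Ordinal.le_iSup (fun z : {y : Y // y ∈ singImage X} => iotaAt ι X z) ⟨y, hy⟩

/-- **The canonical centre of the pair `(Y, X)`**: a Rees algebra `R` on `Y` supported exactly on the maximum locus, whose
stalk filtration at a point of the maximum locus is the canonical centre filtration `J(𝒪_{Y,y}, f_y)` of the local game and
which is trivial off it. [folklore] -/
structure IsCanonicalCentre {Y : Scheme.{0}} (X : Y.IdealSheafData) (R : ReesAlgebraData Y) : Prop where
  /-- the support is the maximum locus -/
  support_eq : R.support = maxLocus ι X
  /-- on the maximum locus the stalks of the pieces are the canonical filtration of the local equation -/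
  stalkIdeal_eq : ∀ y ∈ maxLocus ι X, ∀ n, stalkIdeal (R.piece n) y = J (Y.presheaf.stalk y) (localGenerator X y) n
  /-- off the maximum locus every piece is the unit ideal -/
  stalkIdeal_eq_top : ∀ y ∉ maxLocus ι X, ∀ n, stalkIdeal (R.piece n) y = ⊤

/-- The support of a canonical centre lies in the non-regular locus of `V(X)` (the hypothesis `hsupp` of res-type-057's H1
`nonempty_hypersurfaceTerminatingCentreDatum_of_choice`). [folklore] -/
theorem IsCanonicalCentre.support_subset_singImage {Y : Scheme.{0}} {X : Y.IdealSheafData} {R : ReesAlgebraData Y}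
    (hR : IsCanonicalCentre ι J X R) : R.support ⊆ singImage X := by
  rw [hR.support_eq]
  exact maxLocus_subset_singImage ι X

end Pointwise

/-! ## The total centre rule -/

section CentreRule

variable (ι : (R : Type) → [CommRing R] → R → Ordinal.{0}) (J : (R : Type) → [CommRing R] → R → ℕ → Ideal R)

open scoped Classical in
/-- **The TOTAL centre rule of the assembly**: the canonical centre when one exists, the unit Rees algebra (empty centre)
otherwise. [folklore] -/
def centreRule {k : Type} [Field k] {Y : Scheme.{0}} (_f : Y ⟶ Spec (.of k)) (X : Y.IdealSheafData) :
    ReesAlgebraData Y :=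
  if h : ∃ R : ReesAlgebraData Y, IsCanonicalCentre ι J X R then Classical.choose h else ReesAlgebraData.unit Y

/-- When a canonical centre exists, the centre rule returns one. [folklore] -/
theorem centreRule_spec {k : Type} [Field k] {Y : Scheme.{0}} (f : Y ⟶ Spec (.of k)) (X : Y.IdealSheafData)
    (h : ∃ R : ReesAlgebraData Y, IsCanonicalCentre ι J X R) : IsCanonicalCentre ι J X (centreRule ι J f X) := by
  classical
  unfold centreRule
  rw [dif_pos h]
  exact Classical.choose_spec h

/-- When no canonical centre exists, the centre rule returns the unit Rees algebra. [folklore] -/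
theorem centreRule_of_not_exists {k : Type} [Field k] {Y : Scheme.{0}} (f : Y ⟶ Spec (.of k)) (X : Y.IdealSheafData)
    (h : ¬ ∃ R : ReesAlgebraData Y, IsCanonicalCentre ι J X R) : centreRule ι J f X = ReesAlgebraData.unit Y := by
  classical
  unfold centreRule
  rw [dif_neg h]

/-- The support of the centre rule always lies in the non-regular locus of `V(X)` (empty in the unit case). [folklore] -/
theorem support_centreRule_subset_singImage {k : Type} [Field k] {Y : Scheme.{0}} (f : Y ⟶ Spec (.of k))
    (X : Y.IdealSheafData) : (centreRule ι J f X).support ⊆ singImage X := by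
  classical
  by_cases h : ∃ R : ReesAlgebraData Y, IsCanonicalCentre ι J X R
  · exact (centreRule_spec ι J f X h).support_subset_singImage
  · rw [centreRule_of_not_exists ι J f X h, ReesAlgebraData.support_unit]
    exact Set.empty_subset _

end CentreRule

end Summit.ResolutionOfSingularities.ResolutionOfSingularities.Cruxes.HypersurfaceCentreConstruction.LocalEngine

end
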